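import Summits.CriticalPhenomena.SAWScalingLimit.Theorems.SAWLoopFugacityFlowIsingBoundaryRatioWindowRectRoutes
import Mathlib.Analysis.SpecialFunctions.Trigonometric.ArctanDeriv
import Mathlib.Analysis.Calculus.Deriv.MeanValue
import Mathlib.Topology.UniformSpace.HeineCantor
import HarnessLib

/-!
# Routes outside a Jordan domain with prescribed feet: quantitative separation
(line `fk-anchor-transfer`, crux `IsingBoundaryRatio`, stmt-CriticalPhenomena-10650; helper file of the stub
`windowRectPresentation_holds`)

A quantitative form of `…WindowRectRoutes`. In the disc picture (`H : ℂ ≃ₜ ℂ` maps `closure D` onto the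
closed unit disc) the route of the pair `A` is: radially from its first foot to radius `2`, along the circle of
radius `2`, radially in to its second foot; the route of the pair `B` is the same at radius `3`. If the four
radial angles are pairwise at angular distance `≥ θ₀` (as reals: `θ₀ ≤ |·| ≤ 2π - θ₀`) and the two angles of
`B` keep angular distance `≥ θ₀` from the arc of `A`, the two routes are at distance
`≥ min 1 √(2 - 2 cos θ₀)` in the disc picture (`sep_of_routes`), hence — `H` being uniformly continuous on
the compact `H⁻¹(closed ball of radius 3)` — at a planar distance `≥ η(H, θ₀) > 0` that does not depend on
the feet (`exists_sep_routes`). With the arc of `B` at radius `3` the winding direction of `B` is immaterial,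
so the linked / unlinked case analysis of `…WindowRectRoutes` disappears into the hypothesis on the angles.
Also: the lower bound `2 |u - v| / (1 + U²) ≤ |θ(u) - θ(v)|` for the boundary angle `θ(u) = π + 2 arctan u`
of real chart parameters `|u|, |v| ≤ U` (mean value theorem). [folklore]
-/

noncomputable section

open scoped Real
open Set Metric Complex Literature.Topology.PlaneTopology Literature.Probability.RandomPlanarGeometry

namespace Summit.CriticalPhenomena.SAWScalingLimit.Theorems.IsingBoundaryRatio

namespace WindowRect

/-! ### Distances in the punctured disc picture -/

/-- `cos x ≤ cos θ₀` for `θ₀ ≤ |x| ≤ 2π - θ₀`, `0 ≤ θ₀`. [folklore] -/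
theorem cos_le_cos_of_sep {θ₀ x : ℝ} (h0 : 0 ≤ θ₀) (h1 : θ₀ ≤ |x|) (h2 : |x| ≤ 2 * π - θ₀) :
    Real.cos x ≤ Real.cos θ₀ := by
  rw [← Real.cos_abs x]
  rcases le_or_gt |x| π with h | h
  · exact Real.cos_le_cos_of_nonneg_of_le_pi h0 h h1
  · rw [← Real.cos_two_pi_sub]
    exact Real.cos_le_cos_of_nonneg_of_le_pi h0 (by linarith [abs_nonneg x]) (by linarith)

/-- The squared distance of two polar points. [folklore] -/
theorem normSq_circleMap_sub (t t' α α' : ℝ) :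
    normSq (circleMap 0 t α - circleMap 0 t' α') = t ^ 2 + t' ^ 2 - 2 * t * t' * Real.cos (α - α') := by
  have e : circleMap 0 t α - circleMap 0 t' α' =
      ⟨t * Real.cos α - t' * Real.cos α', t * Real.sin α - t' * Real.sin α'⟩ := by
    apply Complex.ext <;> simp [circleMap, Complex.exp_mul_I, Complex.cos_ofReal_re, Complex.sin_ofReal_re]
  rw [e, Complex.normSq_mk, Real.cos_sub]
  nlinarith [Real.sin_sq_add_cos_sq α, Real.sin_sq_add_cos_sq α']

/-- **Angularly separated polar points of radius `≥ 1` are far apart**: distance `≥ √(2 - 2 cos θ₀)`.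
[folklore] -/
theorem le_dist_circleMap_of_sep {θ₀ : ℝ} (h0 : 0 ≤ θ₀) {α α' t t' : ℝ} (ht : 1 ≤ t) (ht' : 1 ≤ t')
    (h1 : θ₀ ≤ |α - α'|) (h2 : |α - α'| ≤ 2 * π - θ₀) :
    Real.sqrt (2 - 2 * Real.cos θ₀) ≤ dist (circleMap 0 t α) (circleMap 0 t' α') := by
  rw [dist_eq_norm, ← Real.sqrt_sq (norm_nonneg _), ← Complex.normSq_eq_norm_sq, normSq_circleMap_sub]
  apply Real.sqrt_le_sqrt
  have hc := cos_le_cos_of_sep h0 h1 h2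
  have hc1 : Real.cos (α - α') ≤ 1 := Real.cos_le_one _
  nlinarith [mul_nonneg (sub_nonneg.2 ht) (sub_nonneg.2 ht'), mul_nonneg (sub_nonneg.2 hc1) (sub_nonneg.2 ht),
    sq_nonneg (t - t')]

/-- Polar points are at distance at least the difference of their radii. [folklore] -/
theorem abs_sub_le_dist_circleMap (t t' α α' : ℝ) : |(|t| - |t'|)| ≤ dist (circleMap 0 t α) (circleMap 0 t' α') := by
  rw [dist_eq_norm, ← norm_circleMap_zero' t α, ← norm_circleMap_zero' t' α']
  exact abs_norm_sub_norm_le _ _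

/-! ### The two routes in the disc picture and their separation -/

/-- **Separation of the two routes in the disc picture.** Route `A`: legs at angles `α₁, β₁` between radii
`1` and `2`, arc of radius `2` over `uIcc α₁ β₁`; route `B`: legs at `α₂, β₂` between radii `1` and `3`, arc of
radius `3`. If the legs are pairwise `θ₀`-separated and the legs of `B` are `θ₀`-separated from the arc of
`A`, the routes are `min 1 √(2 - 2cos θ₀)` apart. [folklore] -/
theorem sep_of_routes {θ₀ : ℝ} (h0 : 0 ≤ θ₀) {α₁ β₁ α₂ β₂ : ℝ}
    (Hend : ∀ φ, (φ = α₁ ∨ φ = β₁) → ∀ φ', (φ' = α₂ ∨ φ' = β₂) → θ₀ ≤ |φ - φ'| ∧ |φ - φ'| ≤ 2 * π - θ₀)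
    (HB : ∀ θ ∈ uIcc α₁ β₁, ∀ φ', (φ' = α₂ ∨ φ' = β₂) → θ₀ ≤ |θ - φ'| ∧ |θ - φ'| ≤ 2 * π - θ₀)
    {z z' : ℂ}
    (hz : z ∈ range (((Path.segment (circleMap 0 1 α₁) (circleMap 0 2 α₁)).trans (circleArc 0 2 α₁ β₁)).trans
      (Path.segment (circleMap 0 2 β₁) (circleMap 0 1 β₁))))
    (hz' : z' ∈ range (((Path.segment (circleMap 0 1 α₂) (circleMap 0 3 α₂)).trans (circleArc 0 3 α₂ β₂)).trans
      (Path.segment (circleMap 0 3 β₂) (circleMap 0 1 β₂)))) :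
    min 1 (Real.sqrt (2 - 2 * Real.cos θ₀)) ≤ dist z z' := by
  simp only [Path.trans_range, Path.range_segment, mem_union] at hz hz'
  have h12 : (1 : ℝ) ≤ 2 := by norm_num
  have h13 : (1 : ℝ) ≤ 3 := by norm_num
  -- points of `A`: legs (radius `t ∈ [1,2]`, angle `α₁` or `β₁`) or arc (radius `2`)
  have P1 : (∃ t ∈ Icc (1 : ℝ) 2, ∃ φ, (φ = α₁ ∨ φ = β₁) ∧ z = circleMap 0 t φ) ∨
      (∃ θ ∈ uIcc α₁ β₁, z = circleMap 0 2 θ) := by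
    rcases hz with (hz | hz) | hz
    · obtain ⟨t, ht, rfl⟩ := exists_of_mem_radial h12 hz; exact Or.inl ⟨t, ht, α₁, Or.inl rfl, rfl⟩
    · exact Or.inr (exists_of_mem_arc hz)
    · rw [segment_symm] at hz
      obtain ⟨t, ht, rfl⟩ := exists_of_mem_radial h12 hz; exact Or.inl ⟨t, ht, β₁, Or.inr rfl, rfl⟩
  -- points of `B`: legs (radius `t ∈ [1,3]`, angle `α₂` or `β₂`) or arc (radius `3`)
  have P2 : (∃ t ∈ Icc (1 : ℝ) 3, ∃ φ, (φ = α₂ ∨ φ = β₂) ∧ z' = circleMap 0 t φ) ∨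
      (∃ θ, z' = circleMap 0 3 θ) := by
    rcases hz' with (hz' | hz') | hz'
    · obtain ⟨t, ht, rfl⟩ := exists_of_mem_radial h13 hz'; exact Or.inl ⟨t, ht, α₂, Or.inl rfl, rfl⟩
    · obtain ⟨θ, -, rfl⟩ := exists_of_mem_arc hz'; exact Or.inr ⟨θ, rfl⟩
    · rw [segment_symm] at hz'
      obtain ⟨t, ht, rfl⟩ := exists_of_mem_radial h13 hz'; exact Or.inl ⟨t, ht, β₂, Or.inr rfl, rfl⟩
  rcases P1 with ⟨t, ht, φ, hφ, rfl⟩ | ⟨θ, hθ, rfl⟩ <;> rcases P2 with ⟨t', ht', φ', hφ', rfl⟩ | ⟨θ', rfl⟩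
  · obtain ⟨h1, h2⟩ := Hend φ hφ φ' hφ'
    exact (min_le_right _ _).trans (le_dist_circleMap_of_sep h0 ht.1 ht'.1 h1 h2)
  · refine (min_le_left _ _).trans (le_trans ?_ (abs_sub_le_dist_circleMap t 3 φ θ'))
    rw [abs_of_pos (by linarith [ht.1] : (0 : ℝ) < t), abs_of_pos (by norm_num : (0 : ℝ) < 3), abs_sub_comm,
      abs_of_nonneg (by linarith [ht.2])]
    linarith [ht.2]
  · obtain ⟨h1, h2⟩ := HB θ hθ φ' hφ'
    exact (min_le_right _ _).trans (le_dist_circleMap_of_sep h0 (by norm_num) ht'.1 h1 h2)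
  · refine (min_le_left _ _).trans (le_trans ?_ (abs_sub_le_dist_circleMap 2 3 θ θ'))
    norm_num

/-- Points of the routes lie in the closed disc of radius `3` of the disc picture. [folklore] -/
theorem norm_le_three_of_route {R α β : ℝ} (hR : 1 ≤ R) (hR3 : R ≤ 3) {z : ℂ}
    (hz : z ∈ range (((Path.segment (circleMap 0 1 α) (circleMap 0 R α)).trans (circleArc 0 R α β)).trans
      (Path.segment (circleMap 0 R β) (circleMap 0 1 β)))) : ‖z‖ ≤ 3 := by
  simp only [Path.trans_range, Path.range_segment, mem_union] at hz
  rcases hz with (hz | hz) | hz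
  · obtain ⟨t, ht, rfl⟩ := exists_of_mem_radial hR hz
    rw [norm_circleMap_zero', abs_of_pos (by linarith [ht.1])]; linarith [ht.2]
  · obtain ⟨θ, -, rfl⟩ := exists_of_mem_arc hz
    rw [norm_circleMap_zero', abs_of_pos (by linarith)]; exact hR3
  · rw [segment_symm] at hz
    obtain ⟨t, ht, rfl⟩ := exists_of_mem_radial hR hz
    rw [norm_circleMap_zero', abs_of_pos (by linarith [ht.1])]; linarith [ht.2]

/-! ### Pulling back: two outside paths with a uniform planar separation -/

/-- **Two outside paths with prescribed feet, a uniform distance apart.** For the homeomorphism `H` of the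
disc picture and `θ₀ > 0` there is `η > 0` such that: for any four boundary feet with angles satisfying the
separation hypotheses of `sep_of_routes`, there are a path `A` joining the first pair and a path `B` joining
the second pair, both outside `closure D` except at their feet, with `dist z z' ≥ η` for all `z ∈ A`,
`z' ∈ B`. [folklore] -/
theorem exists_sep_routes (D : JordanDomain) (H : ℂ ≃ₜ ℂ) (hH : ∀ z, z ∈ closure D.carrier ↔ ‖H z‖ ≤ 1)
    {θ₀ : ℝ} (h0 : 0 < θ₀) (hθπ : θ₀ ≤ π) :
    ∃ η : ℝ, 0 < η ∧ ∀ (p₁ q₁ p₂ q₂ : ℂ) (α₁ β₁ α₂ β₂ : ℝ),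
      H p₁ = circleMap 0 1 α₁ → H q₁ = circleMap 0 1 β₁ → H p₂ = circleMap 0 1 α₂ → H q₂ = circleMap 0 1 β₂ →
      (∀ φ, (φ = α₁ ∨ φ = β₁) → ∀ φ', (φ' = α₂ ∨ φ' = β₂) → θ₀ ≤ |φ - φ'| ∧ |φ - φ'| ≤ 2 * π - θ₀) →
      (∀ θ ∈ uIcc α₁ β₁, ∀ φ', (φ' = α₂ ∨ φ' = β₂) → θ₀ ≤ |θ - φ'| ∧ |θ - φ'| ≤ 2 * π - θ₀) →
      ∃ (A : Path p₁ q₁) (B : Path p₂ q₂),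
        (∀ z ∈ range A, z ∉ closure D.carrier ∨ z = p₁ ∨ z = q₁) ∧
        (∀ z ∈ range B, z ∉ closure D.carrier ∨ z = p₂ ∨ z = q₂) ∧
        ∀ z ∈ range A, ∀ z' ∈ range B, η ≤ dist z z' := by
  -- uniform continuity of `H` on the compact preimage of the closed disc of radius `3`
  set K : Set ℂ := H.symm '' closedBall (0 : ℂ) 3 with hK
  have hKc : IsCompact K := (isCompact_closedBall 0 3).image H.symm.continuous
  have hUC := hKc.uniformContinuousOn_of_continuous H.continuous.continuousOn
  set s : ℝ := min 1 (Real.sqrt (2 - 2 * Real.cos θ₀)) with hs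
  have hs0 : 0 < s := by
    refine lt_min one_pos (Real.sqrt_pos.2 ?_)
    have : Real.cos θ₀ < 1 := by
      rw [← Real.cos_zero]
      exact Real.cos_lt_cos_of_nonneg_of_le_pi le_rfl hθπ h0
    linarith
  obtain ⟨η, hη, hU⟩ := Metric.uniformContinuousOn_iff.1 hUC s hs0
  refine ⟨η, hη, fun p₁ q₁ p₂ q₂ α₁ β₁ α₂ β₂ hp₁ hq₁ hp₂ hq₂ Hend HB => ?_⟩
  set Aw := ((Path.segment (circleMap 0 1 α₁) (circleMap 0 2 α₁)).trans (circleArc 0 2 α₁ β₁)).trans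
    (Path.segment (circleMap 0 2 β₁) (circleMap 0 1 β₁)) with hAw
  set Bw := ((Path.segment (circleMap 0 1 α₂) (circleMap 0 3 α₂)).trans (circleArc 0 3 α₂ β₂)).trans
    (Path.segment (circleMap 0 3 β₂) (circleMap 0 1 β₂)) with hBw
  have ep₁ : p₁ = H.symm (circleMap 0 1 α₁) := by rw [← hp₁, H.symm_apply_apply]
  have eq₁ : q₁ = H.symm (circleMap 0 1 β₁) := by rw [← hq₁, H.symm_apply_apply]
  have ep₂ : p₂ = H.symm (circleMap 0 1 α₂) := by rw [← hp₂, H.symm_apply_apply]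
  have eq₂ : q₂ = H.symm (circleMap 0 1 β₂) := by rw [← hq₂, H.symm_apply_apply]
  refine ⟨(Aw.map H.symm.continuous).cast ep₁ eq₁, (Bw.map H.symm.continuous).cast ep₂ eq₂, ?_, ?_, ?_⟩
  · intro z hz
    rw [Path.cast_coe, Path.map_coe, range_comp] at hz
    obtain ⟨w, hw, rfl⟩ := hz
    obtain ⟨h1, h1'⟩ := route_norm (R := 2) (by norm_num) hw
    rcases h1.eq_or_lt with h | h
    · rcases h1' h.symm with rfl | rfl
      · exact Or.inr (Or.inl ep₁.symm)
      · exact Or.inr (Or.inr eq₁.symm)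
    · left; rw [hH, H.apply_symm_apply]; exact not_le.2 h
  · intro z hz
    rw [Path.cast_coe, Path.map_coe, range_comp] at hz
    obtain ⟨w, hw, rfl⟩ := hz
    obtain ⟨h1, h1'⟩ := route_norm (R := 3) (by norm_num) hw
    rcases h1.eq_or_lt with h | h
    · rcases h1' h.symm with rfl | rfl
      · exact Or.inr (Or.inl ep₂.symm)
      · exact Or.inr (Or.inr eq₂.symm)
    · left; rw [hH, H.apply_symm_apply]; exact not_le.2 h
  · intro z hz z' hz'
    rw [Path.cast_coe, Path.map_coe, range_comp] at hz hz'
    obtain ⟨w, hw, rfl⟩ := hz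
    obtain ⟨w', hw', rfl⟩ := hz'
    have hwK : H.symm w ∈ K := ⟨w, mem_closedBall_zero_iff.2 (norm_le_three_of_route (by norm_num) (by norm_num) hw), rfl⟩
    have hw'K : H.symm w' ∈ K := ⟨w', mem_closedBall_zero_iff.2 (norm_le_three_of_route (by norm_num) le_rfl hw'), rfl⟩
    by_contra hlt
    push Not at hlt
    have h := hU _ hwK _ hw'K hlt
    rw [H.apply_symm_apply, H.apply_symm_apply] at h
    exact (not_le.2 h) (sep_of_routes h0.le Hend HB hw hw')

/-- **One outside path with prescribed feet.** [folklore] -/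
theorem exists_outside_path (D : JordanDomain) (H : ℂ ≃ₜ ℂ) (hH : ∀ z, z ∈ closure D.carrier ↔ ‖H z‖ ≤ 1)
    {p q : ℂ} {α β : ℝ} (hp : H p = circleMap 0 1 α) (hq : H q = circleMap 0 1 β) :
    ∃ A : Path p q, ∀ z ∈ range A, z ∉ closure D.carrier ∨ z = p ∨ z = q := by
  set Aw := ((Path.segment (circleMap 0 1 α) (circleMap 0 2 α)).trans (circleArc 0 2 α β)).trans
    (Path.segment (circleMap 0 2 β) (circleMap 0 1 β)) with hAw
  have ep : p = H.symm (circleMap 0 1 α) := by rw [← hp, H.symm_apply_apply]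
  have eq : q = H.symm (circleMap 0 1 β) := by rw [← hq, H.symm_apply_apply]
  refine ⟨(Aw.map H.symm.continuous).cast ep eq, fun z hz => ?_⟩
  rw [Path.cast_coe, Path.map_coe, range_comp] at hz
  obtain ⟨w, hw, rfl⟩ := hz
  obtain ⟨h1, h1'⟩ := route_norm (R := 2) (by norm_num) hw
  rcases h1.eq_or_lt with h | h
  · rcases h1' h.symm with rfl | rfl
    · exact Or.inr (Or.inl ep.symm)
    · exact Or.inr (Or.inr eq.symm)
  · left; rw [hH, H.apply_symm_apply]; exact not_le.2 h

/-! ### Angles from real boundary parameters: a lower bound on their separation -/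

/-- **The boundary angle separates parameters**: `2 (u - v) / (1 + U²) ≤ θ(u) - θ(v)` for `v ≤ u` in
`[-U, U]`, `θ(u) = π + 2 arctan u` (mean value theorem). [folklore] -/
theorem angle_sub_angle_ge {U u v : ℝ} (hu : |u| ≤ U) (hv : |v| ≤ U) (hvu : v ≤ u) :
    2 * (u - v) / (1 + U ^ 2) ≤ (π + 2 * Real.arctan u) - (π + 2 * Real.arctan v) := by
  rcases hvu.eq_or_lt with rfl | hlt
  · simp
  · obtain ⟨c, hc, hder⟩ := exists_hasDerivAt_eq_slope Real.arctan (fun x => 1 / (1 + x ^ 2)) hlt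
      Real.continuous_arctan.continuousOn (fun x _ => Real.hasDerivAt_arctan x)
    have hcU : c ^ 2 ≤ U ^ 2 := by
      have hc' : |c| ≤ U := by
        rw [abs_le] at hu hv ⊢; constructor <;> linarith [hc.1, hc.2]
      calc c ^ 2 = |c| ^ 2 := (sq_abs c).symm
        _ ≤ U ^ 2 := pow_le_pow_left₀ (abs_nonneg c) hc' 2
    have hslope : Real.arctan u - Real.arctan v = (u - v) * (1 / (1 + c ^ 2)) := by
      rw [hder, mul_div_cancel₀ _ (sub_ne_zero.2 hlt.ne')]
    have hpos : (0 : ℝ) < 1 + c ^ 2 := by positivity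
    have hposU : (0 : ℝ) < 1 + U ^ 2 := by positivity
    have key : (u - v) / (1 + U ^ 2) ≤ (u - v) / (1 + c ^ 2) :=
      div_le_div_of_nonneg_left (sub_nonneg.2 hvu) hpos (by linarith)
    rw [show (π + 2 * Real.arctan u) - (π + 2 * Real.arctan v) = 2 * (Real.arctan u - Real.arctan v) by ring,
      hslope, mul_one_div, mul_div_assoc]
    linarith

/-- The same, in absolute values: `2 |u - v| / (1 + U²) ≤ |θ(u) - θ(v)|`. [folklore] -/
theorem abs_angle_sub_angle_ge {U u v : ℝ} (hu : |u| ≤ U) (hv : |v| ≤ U) :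
    2 * |u - v| / (1 + U ^ 2) ≤ |(π + 2 * Real.arctan u) - (π + 2 * Real.arctan v)| := by
  have hposU : (0 : ℝ) < 1 + U ^ 2 := by positivity
  rcases le_total v u with h | h
  · have hge := angle_sub_angle_ge hu hv h
    have hnn : 0 ≤ 2 * (u - v) / (1 + U ^ 2) := div_nonneg (by linarith) hposU.le
    rw [abs_of_nonneg (sub_nonneg.2 h), abs_of_nonneg (hnn.trans hge)]
    exact hge
  · have hge := angle_sub_angle_ge hv hu h
    have hnn : 0 ≤ 2 * (v - u) / (1 + U ^ 2) := div_nonneg (by linarith) hposU.le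
    rw [abs_sub_comm u v, abs_sub_comm (π + 2 * Real.arctan u), abs_of_nonneg (sub_nonneg.2 h),
      abs_of_nonneg (hnn.trans hge)]
    exact hge

/-- Boundary angles of parameters `|u| ≤ U` differ by at most `2π - 2 (π - 2 arctan U)`, i.e. they stay
`θ_U = π - 2 arctan U`-away from a full turn. [folklore] -/
theorem abs_angle_sub_angle_le {U u v : ℝ} (hu : |u| ≤ U) (hv : |v| ≤ U) :
    |(π + 2 * Real.arctan u) - (π + 2 * Real.arctan v)| ≤ 2 * π - 2 * (π - 2 * Real.arctan U) := by
  rw [abs_le] at hu hv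
  have h1 := Real.arctan_strictMono.monotone hu.2
  have h2 := Real.arctan_strictMono.monotone hv.2
  have h3 := Real.arctan_strictMono.monotone hu.1
  have h4 := Real.arctan_strictMono.monotone hv.1
  rw [Real.arctan_neg] at h3 h4
  rw [abs_le]; constructor <;> linarith

/-- `θ_U = π - 2 arctan U` is positive. [folklore] -/
theorem angleMargin_pos (U : ℝ) : 0 < π - 2 * Real.arctan U := by
  linarith [Real.arctan_lt_pi_div_two U]

end WindowRect

/-- **Angularly separated polar points of radius `≥ 1` are far apart**, closed form (registered sub-goal of
stmt-CriticalPhenomena-10650). [folklore] -/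
theorem windowRect_le_dist_circleMap_of_sep : ∀ {θ₀ : ℝ}, 0 ≤ θ₀ → ∀ {α α' t t' : ℝ}, 1 ≤ t → 1 ≤ t' → θ₀ ≤ |α - α'| → |α - α'| ≤ 2 * Real.pi - θ₀ → Real.sqrt (2 - 2 * Real.cos θ₀) ≤ dist (circleMap 0 t α) (circleMap 0 t' α') :=
  fun h0 _ _ _ _ ht ht' h1 h2 => WindowRect.le_dist_circleMap_of_sep h0 ht ht' h1 h2

end Summit.CriticalPhenomena.SAWScalingLimit.Theorems.IsingBoundaryRatio

end
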